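import Summits.CriticalPhenomena.PercolationContinuityZ3.Theorems.SahiLiebSahiContinuumRealKernel

/-!
# Gaussian regression: `(X, aX + c + √v·Z)` with `a ≥ 0` is Sahi-positive of every order, for ANY law of `X`

A worked instance of `SahiLiebSahiContinuumRealKernel.lean` (cell `prim-sahi`, typer, generation 9; `--supports
stmt-CriticalPhenomena-4575`): the Gaussian regression kernel `x ↦ N(a x + c, v)` is a Markov kernel `ℝ → ℝ`
(`gaussianRegressionKernel`, measurability from Mathlib's `measurable_gaussianReal`), stochastically increasing for
`a ≥ 0` (`gaussianRegressionKernel_Iic_antitone`: `N(m, v)((−∞,t]) = N(0, v)((−∞, t − m])` decreases in `m`), so for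
EVERY probability measure `μ₁` on `ℝ` (the law of `X`; no Gaussianity, no density) the joint law
`μ₁ ⊗ₘ (x ↦ N(a x + c, v))` of `(X, aX + c + √v Z)` satisfies Sahi's `E_n(f_0,…,f_{n−1}) ≥ 0` for every `n` and all
bounded nonnegative monotone increasing measurable `f_i : ℝ² → ℝ` (`msahiE_gaussianRegression_nonneg`).  With
`μ₁ = N(m₁, v₁)` this is again the positively correlated bivariate Gaussian of `SahiLiebSahiContinuumReal.lean`.
-/

noncomputable section

namespace Summit.CriticalPhenomena.PercolationContinuityZ3.Theorems

open MeasureTheory ProbabilityTheory Set Literature.Combinatorics.Sahi2008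
open scoped NNReal

/-- **The Gaussian regression kernel** `x ↦ N(a x + c, v)` (the conditional law of `Y = aX + c + √v·Z`, `Z` standard
normal independent of `X`). [folklore] -/
def gaussianRegressionKernel (a c : ℝ) (v : ℝ≥0) : Kernel ℝ ℝ where
  toFun x := gaussianReal (a * x + c) v
  measurable' :=
    measurable_gaussianReal.comp (((measurable_id.const_mul a).add_const c).prodMk measurable_const)

/-- The value of the regression kernel. [folklore] -/
theorem gaussianRegressionKernel_apply (a c : ℝ) (v : ℝ≥0) (x : ℝ) :
    gaussianRegressionKernel a c v x = gaussianReal (a * x + c) v := rfl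

/-- The regression kernel is a Markov kernel. [folklore] -/
instance instIsMarkovKernelGaussianRegressionKernel (a c : ℝ) (v : ℝ≥0) :
    IsMarkovKernel (gaussianRegressionKernel a c v) :=
  ⟨fun x => by rw [gaussianRegressionKernel_apply]; infer_instance⟩

/-- The Gaussian distribution function is a shift: `N(m, v)((−∞, t]) = N(0, v)((−∞, t − m])`. [folklore] -/
theorem gaussianReal_Iic_eq (m : ℝ) (v : ℝ≥0) (t : ℝ) :
    gaussianReal m v (Set.Iic t) = gaussianReal 0 v (Set.Iic (t - m)) := by
  have h := gaussianReal_map_add_const (μ := 0) (v := v) m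
  rw [zero_add] at h
  rw [← h, Measure.map_apply (measurable_add_const m) measurableSet_Iic, Set.preimage_add_const_Iic]

/-- **The regression kernel with nonnegative slope is stochastically increasing**: for `a ≥ 0` and `x ≤ y`,
`N(a y + c, v)((−∞,t]) ≤ N(a x + c, v)((−∞,t])`. [folklore] -/
theorem gaussianRegressionKernel_Iic_antitone {a : ℝ} (ha : 0 ≤ a) (c : ℝ) (v : ℝ≥0) ⦃x y : ℝ⦄ (hxy : x ≤ y)
    (t : ℝ) : gaussianRegressionKernel a c v y (Set.Iic t) ≤ gaussianRegressionKernel a c v x (Set.Iic t) := by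
  rw [gaussianRegressionKernel_apply, gaussianRegressionKernel_apply, gaussianReal_Iic_eq (a * y + c),
    gaussianReal_Iic_eq (a * x + c)]
  have hxy' : a * x ≤ a * y := mul_le_mul_of_nonneg_left hxy ha
  exact measure_mono (μ := gaussianReal 0 v) (Set.Iic_subset_Iic.2 (by linarith : t - (a * y + c) ≤ t - (a * x + c)))

/-- **Gaussian regression is Sahi-positive of every order, whatever the law of the regressor**: for every
probability measure `μ₁` on `ℝ`, `a ≥ 0`, `c ∈ ℝ`, `v ≥ 0`, every `n` and all bounded nonnegative monotone increasing
measurable `f_0,…,f_{n−1} : ℝ² → ℝ`, `E_n(f_0,…,f_{n−1}) ≥ 0` under the joint law `μ₁ ⊗ₘ (x ↦ N(a x + c, v))` of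
`(X, aX + c + √v·Z)`, `X ~ μ₁`, `Z ~ N(0,1)` independent. [this work] -/
theorem msahiE_gaussianRegression_nonneg (μ₁ : Measure ℝ) [IsProbabilityMeasure μ₁] {a : ℝ} (ha : 0 ≤ a)
    (c : ℝ) (v : ℝ≥0) (n : ℕ) (f : Fin n → ℝ × ℝ → ℝ) (hfm : ∀ i, Measurable (f i)) (hf0 : ∀ i p, 0 ≤ f i p)
    {M : ℝ} (hfM : ∀ i p, f i p ≤ M) (hmono : ∀ i, Monotone (f i)) :
    0 ≤ msahiE (μ₁ ⊗ₘ gaussianRegressionKernel a c v) n f :=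
  msahiE_compProd_real_nonneg μ₁ (gaussianRegressionKernel a c v) (gaussianRegressionKernel_Iic_antitone ha c v) n
    f hfm hf0 hfM hmono

end Summit.CriticalPhenomena.PercolationContinuityZ3.Theorems
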